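import Mathlib
import HarnessLib

/-!
# Colons of tightly closed ideals are tightly closed (crux `FrobeniusLadder.FRationalResolution`, line `Sketch`)

Stub `stub_colon_tightlyClosed` of the skeleton `Sketch` for crux stmt-ResolutionOfSingularities-15317.
An ideal `I` of a commutative ring `R` is "tightly closed (inline clause, exponent base `p`)" when
`∀ y c, c ≠ 0 → (∀ e, c * y^(p^e) ∈ span {z^(p^e) | z ∈ I}) → y ∈ I`. This file proves that the
clause passes from `I` to every colon ideal `I.colon K = (I : K)`, `K ⊆ R` an arbitrary subset.

Proof: to get `y ∈ (I : K)` fix `k ∈ K` and show `y * k ∈ I` by the clause for `I` with the same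
multiplier `c`: for each `e`, `c * (y * k)^(p^e) = (c * y^(p^e)) * k^(p^e)`, and multiplication by
`k^(p^e)` maps `span {z^(p^e) | z ∈ (I : K)}` into `span {z^(p^e) | z ∈ I}` because
`z^(p^e) * k^(p^e) = (z * k)^(p^e)` with `z * k ∈ I`. No hypothesis on `p`, on the characteristic, or on
zero divisors is used.
-/

set_option linter.dupNamespace false

namespace Summit.ResolutionOfSingularities.ResolutionOfSingularities.Theorems.FRationalResolution

/-- Multiplication by `k ^ q`, `k ∈ K`, maps the span of the `q`-th powers of the colon ideal `(I : K)`
into the span of the `q`-th powers of `I`: if `x ∈ span {z^q | z ∈ (I : K)}` then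
`x * k^q ∈ span {z^q | z ∈ I}` (on generators, `z^q * k^q = (z * k)^q` and `z * k ∈ I`). -/
theorem mul_pow_mem_span_pow_image_of_mem_span_colon {R : Type} [CommRing R] (I : Ideal R)
    (K : Set R) (q : ℕ) {k : R} (hk : k ∈ K) {x : R}
    (hx : x ∈ Ideal.span ((fun z : R => z ^ q) '' (I.colon K : Set R))) :
    x * k ^ q ∈ Ideal.span ((fun z : R => z ^ q) '' (I : Set R)) := by
  induction hx using Submodule.span_induction with
  | mem w hw =>
    obtain ⟨z, hz, rfl⟩ := hw
    change z ^ q * k ^ q ∈ _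
    rw [← mul_pow]
    exact Ideal.subset_span ⟨z * k, Submodule.mem_colon.mp hz k hk, rfl⟩
  | zero =>
    rw [zero_mul]
    exact Submodule.zero_mem _
  | add a b _ _ ha hb =>
    rw [add_mul]
    exact Ideal.add_mem _ ha hb
  | smul r a _ ha =>
    rw [smul_eq_mul, mul_assoc]
    exact Ideal.mul_mem_left _ r ha

/-- COLONS OF TIGHTLY CLOSED IDEALS ARE TIGHTLY CLOSED (inline clause). If the ideal `I` satisfies
`∀ y c, c ≠ 0 → (∀ e, c * y^(p^e) ∈ span {z^(p^e) | z ∈ I}) → y ∈ I`, then so does the colon ideal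
`I.colon K = {r | r • K ⊆ I}` for every subset `K ⊆ R`. -/
theorem stub_colon_tightlyClosed (p : ℕ) (R : Type) [CommRing R] (I : Ideal R) (K : Set R)
    (hI : ∀ y c : R, c ≠ 0 →
      (∀ e : ℕ, c * y ^ p ^ e ∈ Ideal.span ((fun z : R => z ^ p ^ e) '' (I : Set R))) → y ∈ I) :
    ∀ y c : R, c ≠ 0 →
      (∀ e : ℕ, c * y ^ p ^ e ∈ Ideal.span ((fun z : R => z ^ p ^ e) '' (I.colon K : Set R))) →
      y ∈ I.colon K := by
  intro y c hc hy
  refine Submodule.mem_colon.mpr fun k hk => ?_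
  rw [smul_eq_mul]
  refine hI (y * k) c hc fun e => ?_
  rw [mul_pow, ← mul_assoc]
  exact mul_pow_mem_span_pow_image_of_mem_span_colon I K (p ^ e) hk (hy e)

end Summit.ResolutionOfSingularities.ResolutionOfSingularities.Theorems.FRationalResolution
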